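import Summits.BirchSwinnertonDyer.BirchSwinnertonDyer.Theorems.AlignedTransportAtTwoMainConjectureOfRankZeroBSDAtTwoFineRoadKleinCounting
import Mathlib.GroupTheory.Coset.Card
import Mathlib.GroupTheory.QuotientGroup.Basic
import HarnessLib

/-!
# Route `AlignedTransportAtTwo`, crux C2 `MainConjectureOfRankZeroBSDAtTwo` (stmt-BirchSwinnertonDyer-22298),
# road (b″): PERFECT DESCENT at `2`, part VII — the COUNTING LEMMA for `Q̄ = S₃`:
# `#((1 − e₁)V) ≤ #Hom_{S₃}(V, V₄)² ` and `#Hom_{S₃}(V, V₄) ≤ #((1 − e₁)V)`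

Cell `bsd-f1-sign2`, WIDTH-5 attach seat `bsd-line-att-p3` (gen 4) on line `birth` of crux C2
(`--supports` stmt-BirchSwinnertonDyer-22298; closes nothing). HONEST FRAMING: THEOREMS ONLY — no definition, no
named fact, no instance, no `sorry`; BSD is NOT proved by any of this. Sequel of `…FineRoadKleinCounting`
(`#Hom_σ(V, M) = #((1 − e₁)V)`): the lead's FREE target (c1), PERFECT-DESCENT.md §3 (iii), for the full image
`Q̄ = S₃ = ⟨σ̄, τ̄⟩` (`σ` fixed-point-free on `M`, `τ` a transposition fixing `m₀ ≠ 0`). Setting as in part VI: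
`M` Klein, `V` a `2`-torsion `Q`-module on which the kernel `N` of the action on `M` acts trivially.

## What is proved

* §1 relations: `τ(σ m₀) = σ² m₀`, `τ² = 1`, `τσ = σ²τ`, `τσ² = στ` on `M` (`tau_smul_sigma_smul`, `tau_tau`,
  `tau_sigma`, `tau_sigma_sigma`) and hence on `V` (`tau_tau_V`, `tau_sigma_V`, `tau_sigma_sigma_V`); the SIX-ELEMENT
  CLASSIFICATION `smul_cases_S3`: every `g ∈ Q` acts on `M` as `1, σ, σ², τ, τσ` or `τσ²`
  (`smul_eq_smul_of_fix`: two transpositions with the same fixed point coincide); so **`equivariant_iff_sigma_tau`**: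
  `Hom_Q(V, M) = {f | f σ = σ f, f τ = τ f}`.
* §2 the AVERAGING operator `T f = f + τ f τ` maps `Hom_σ(V, M)` into `Hom_{σ,τ}(V, M)` additively with kernel
  inside `Hom_{σ,τ}(V, M)` (`-1 = 1` on `M`); hence, by `#G = #(G/ker)·#ker`,
  **`natCard_ker_e1_le_sq`**: `#((1 − e₁)V) = #Hom_σ(V, M) ≤ #Hom_{σ,τ}(V, M)²`, and trivially
  **`natCard_sigmaTauEquivariant_le`**: `#Hom_{σ,τ}(V, M) ≤ #Hom_σ(V, M) = #((1 − e₁)V)`.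
* §3 **`natCard_equivariant_S3_bounds`**: for `Q̄ = S₃`,
  `#((1 − e₁)V) ≤ #Hom_Q(V, M)²` and `#Hom_Q(V, M) ≤ #((1 − e₁)V)` — i.e.
  `½·dim_{𝔽₂}(1 − e₁)V ≤ dim_{𝔽₂} Hom_{S₃}(V, V₄) ≤ dim_{𝔽₂}(1 − e₁)V`; in particular `Hom_{S₃}(V, V₄)` is bounded
  iff `(1 − e₁)V` is, which is what the `Λ`-adic form of the note («`Hom_{S₃}(X/2X, V₄)` finite ⟺ `μ((1 − e₁)X) = 0`»)
  consumes. (The note's exact value `dim = ½ dim (1 − e₁)V` — Galois descent along `τ` — is not needed for that and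
  is not proved here.)

References: J.-P. Serre, *Linear Representations of Finite Groups*, §2.6; PERFECT-DESCENT.md §3 (iii) (lead att-p2 g4).
-/

set_option autoImplicit false
-- the Theorems namespace of this sub repeats the summit name by design (D-0017 nested layout)
set_option linter.dupNamespace false

namespace Summit.BirchSwinnertonDyer.BirchSwinnertonDyer.Theorems.AlignedTransportAtTwoFineRoad.PerfectDescent

open Summit.BirchSwinnertonDyer.BirchSwinnertonDyer.Theorems.MultTransportAtTwo

variable {Q : Type*} [Group Q] {M : Type*} [AddCommGroup M] [DistribMulAction Q M]
  {V : Type*} [AddCommGroup V] [DistribMulAction Q V]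

/-! ## §1 The relations of `S₃ = ⟨σ, τ⟩` on `M` and on `V`; the six-element classification -/

section Relations

/-- Two NON-trivial elements fixing the same non-zero `a ∈ M` act identically (both swap the other two non-zero
elements). [folklore] -/
theorem smul_eq_smul_of_fix (h4 : Nat.card M = 4) (h2 : ∀ m : M, m + m = 0) {a b : M} (ha : a ≠ 0) (hb : b ≠ 0)
    (hab : a ≠ b) {g g' : Q} (hg : ¬ ∀ m : M, g • m = m) (hga : g • a = a) (hg' : ¬ ∀ m : M, g' • m = m)
    (hg'a : g' • a = a) (m : M) : g • m = g' • m := by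
  have key : ∀ q : Q, (¬ ∀ m : M, q • m = m) → q • a = a → q • b = a + b := by
    intro q hq hqa
    rcases klein_cases h4 h2 ha hb hab (q • b) with e | e | e | e
    · exact absurd ((smul_eq_zero_iff_eq q).mp e) hb
    · rw [← hqa] at e; exact absurd (smul_left_cancel q e) hab.symm
    · exact absurd (smul_eq_self_of_generators h4 h2 ha hb hab hqa e) hq
    · exact e
  exact smul_eq_smul_of_generators h4 h2 ha hb hab (by rw [hga, hg'a]) (by rw [key g hg hga, key g' hg' hg'a]) m

variable (h4 : Nat.card M = 4) (h2 : ∀ m : M, m + m = 0) {σ τ : Q} {m₀ : M}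
  (hσ : ∀ m : M, σ • m = m → m = 0) (hm₀ : m₀ ≠ 0) (hτ0 : τ • m₀ = m₀) (hτ : ¬ ∀ m : M, τ • m = m)
include h4 h2 hσ hm₀ hτ0 hτ

/-- `τ (σ m₀) = σ² m₀ = m₀ + σ m₀`: the transposition fixing `m₀` swaps `σ m₀` and `σ² m₀`. [folklore] -/
theorem tau_smul_sigma_smul : τ • (σ • m₀) = σ • (σ • m₀) := by
  have hσm0 : σ • m₀ ≠ 0 := fun h ↦ hm₀ ((smul_eq_zero_iff_eq σ).mp h)
  have hσm : σ • m₀ ≠ m₀ := fun h ↦ hm₀ (hσ m₀ h)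
  rcases klein_cases h4 h2 hm₀ hσm0 (Ne.symm hσm) (τ • (σ • m₀)) with e | e | e | e
  · exact absurd ((smul_eq_zero_iff_eq τ).mp e) hσm0
  · have e' : τ • (σ • m₀) = τ • m₀ := by rw [hτ0]; exact e
    exact absurd (smul_left_cancel τ e') hσm
  · exact absurd (smul_eq_self_of_generators h4 h2 hm₀ hσm0 (Ne.symm hσm) hτ0 e) hτ
  · rw [e, smul_smul_eq_add_of_fpf h4 h2 hσ]

/-- `τ² = 1` on `M`. [folklore] -/
theorem tau_tau (m : M) : τ • (τ • m) = m := by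
  have hσm0 : σ • m₀ ≠ 0 := fun h ↦ hm₀ ((smul_eq_zero_iff_eq σ).mp h)
  have hσm : σ • m₀ ≠ m₀ := fun h ↦ hm₀ (hσ m₀ h)
  have hts := tau_smul_sigma_smul h4 h2 hσ hm₀ hτ0 hτ
  have h := smul_eq_self_of_generators h4 h2 hm₀ hσm0 (Ne.symm hσm) (q := τ * τ)
    (by rw [mul_smul, hτ0, hτ0]) (by
      rw [mul_smul, hts, smul_smul_eq_add_of_fpf h4 h2 hσ, smul_add, hτ0, hts, smul_smul_eq_add_of_fpf h4 h2 hσ,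
        ← add_assoc, h2, zero_add]) m
  rwa [mul_smul] at h

/-- `τσ = σ²τ` on `M` (`S₃` relation). [folklore] -/
theorem tau_sigma (m : M) : τ • (σ • m) = σ • (σ • (τ • m)) := by
  have hσm0 : σ • m₀ ≠ 0 := fun h ↦ hm₀ ((smul_eq_zero_iff_eq σ).mp h)
  have hσm : σ • m₀ ≠ m₀ := fun h ↦ hm₀ (hσ m₀ h)
  have hts := tau_smul_sigma_smul h4 h2 hσ hm₀ hτ0 hτ
  have hσσ := smul_smul_eq_add_of_fpf h4 h2 hσ
  have hσ3 := smul_smul_smul_eq_self_of_fpf h4 h2 hσ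
  have h := smul_eq_smul_of_generators h4 h2 hm₀ hσm0 (Ne.symm hσm) (q := τ * σ) (r := σ * σ * τ)
    (by rw [mul_smul, hts, mul_smul, mul_smul, hτ0])
    (by rw [mul_smul, hσσ, smul_add, hτ0, hts, hσσ, ← add_assoc, h2, zero_add, mul_smul, mul_smul, hts, hσ3]) m
  rwa [mul_smul, mul_smul, mul_smul] at h

/-- `τσ² = στ` on `M`. [folklore] -/
theorem tau_sigma_sigma (m : M) : τ • (σ • (σ • m)) = σ • (τ • m) := by
  rw [tau_sigma h4 h2 hσ hm₀ hτ0 hτ, tau_sigma h4 h2 hσ hm₀ hτ0 hτ, smul_smul_smul_eq_self_of_fpf h4 h2 hσ]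

/-- **Six-element classification**: every `g ∈ Q` acts on `M` as `1`, `σ`, `σ²`, `τ`, `τσ` or `τσ²`
(`Q̄ = Aut(V₄) ≅ S₃`). [folklore] -/
theorem smul_cases_S3 (g : Q) :
    (∀ m : M, g • m = m) ∨ (∀ m : M, g • m = σ • m) ∨ (∀ m : M, g • m = (σ * σ) • m) ∨
      (∀ m : M, g • m = τ • m) ∨ (∀ m : M, g • m = (τ * σ) • m) ∨ (∀ m : M, g • m = (τ * σ * σ) • m) := by
  have hσm0 : σ • m₀ ≠ 0 := fun h ↦ hm₀ ((smul_eq_zero_iff_eq σ).mp h)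
  have hσm : σ • m₀ ≠ m₀ := fun h ↦ hm₀ (hσ m₀ h)
  have hts := tau_smul_sigma_smul h4 h2 hσ hm₀ hτ0 hτ
  have hσσ := smul_smul_eq_add_of_fpf h4 h2 hσ
  have hσ3 := smul_smul_smul_eq_self_of_fpf h4 h2 hσ
  by_cases htriv : ∀ m : M, g • m = m
  · exact Or.inl htriv
  by_cases hfpf : ∀ m : M, g • m = m → m = 0
  · rcases fpf_smul_dichotomy h4 h2 hσ hfpf with e | e
    · exact Or.inr (Or.inl e)
    · exact Or.inr (Or.inr (Or.inl fun m ↦ by rw [e, mul_smul]))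
  push Not at hfpf
  obtain ⟨a₁, ha₁g, ha₁⟩ := hfpf
  right; right; right
  -- the fixed point `a₁` is `m₀`, `σ m₀` or `m₀ + σ m₀ = σ² m₀`
  rcases klein_cases h4 h2 hm₀ hσm0 (Ne.symm hσm) a₁ with e | e | e | e
  · exact absurd e ha₁
  · rw [e] at ha₁g
    exact Or.inl (smul_eq_smul_of_fix h4 h2 hm₀ hσm0 (Ne.symm hσm) htriv ha₁g hτ hτ0)
  · rw [e] at ha₁g
    refine Or.inr (Or.inl (smul_eq_smul_of_fix h4 h2 hσm0 hm₀ hσm htriv ha₁g ?_ ?_))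
    · intro h
      have h' := h m₀
      rw [mul_smul, hts, hσσ] at h'
      exact hσm0 (by simpa using h')
    · rw [mul_smul, hσσ, smul_add, hτ0, hts, hσσ, ← add_assoc, h2, zero_add]
  · rw [e] at ha₁g
    have hne : m₀ + σ • m₀ ≠ 0 := by rw [← hσσ]; exact fun h ↦ hσm0 ((smul_eq_zero_iff_eq σ).mp h)
    have hne' : m₀ + σ • m₀ ≠ m₀ := fun h ↦ hσm0 (by simpa using h)
    refine Or.inr (Or.inr (smul_eq_smul_of_fix h4 h2 hne hm₀ hne' htriv ha₁g ?_ ?_))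
    · intro h
      have h' := h m₀
      rw [mul_smul, mul_smul, hσσ, smul_add, hτ0, hts, hσσ, ← add_assoc, h2, zero_add] at h'
      exact hσm h'
    · rw [mul_smul, mul_smul, ← hσσ, hσ3, hts, hσσ]

variable (hVN : ∀ g : Q, (∀ m : M, g • m = m) → ∀ v : V, g • v = v)
include hVN

/-- `τ² = 1` on `V`. [folklore] -/
theorem tau_tau_V (v : V) : τ • (τ • v) = v := by
  have h := hVN (τ * τ) (fun m ↦ by rw [mul_smul]; exact tau_tau h4 h2 hσ hm₀ hτ0 hτ m) v
  rwa [mul_smul] at h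

/-- `τσ = σ²τ` on `V`. [folklore] -/
theorem tau_sigma_V (v : V) : τ • (σ • v) = σ • (σ • (τ • v)) := by
  have h := hVN ((σ * σ * τ)⁻¹ * (τ * σ)) (fun m ↦ by
    rw [mul_smul, inv_smul_eq_iff, mul_smul, mul_smul, mul_smul]
    exact tau_sigma h4 h2 hσ hm₀ hτ0 hτ m) v
  rw [mul_smul, inv_smul_eq_iff, mul_smul, mul_smul, mul_smul] at h
  exact h

/-- `τσ² = στ` on `V`. [folklore] -/
theorem tau_sigma_sigma_V (v : V) : τ • (σ • (σ • v)) = σ • (τ • v) := by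
  rw [tau_sigma_V h4 h2 hσ hm₀ hτ0 hτ hVN, tau_sigma_V h4 h2 hσ hm₀ hτ0 hτ hVN,
    smul_smul_smul_eq_self_of_kernel h4 h2 hσ hVN]

/-- **`Hom_Q(V, M) = Hom_{σ,τ}(V, M)`**: an additive map is `Q`-equivariant iff it commutes with `σ` and `τ`
(every `g` acts on `M` and on `V` as one of `1, σ, σ², τ, τσ, τσ²`, `smul_cases_S3`, the kernel acting trivially on
both). [folklore] -/
theorem equivariant_iff_sigma_tau (f : V →+ M) :
    (∀ (g : Q) (v : V), f (g • v) = g • f v) ↔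
      (∀ v : V, f (σ • v) = σ • f v) ∧ ∀ v : V, f (τ • v) = τ • f v := by
  refine ⟨fun h ↦ ⟨h σ, h τ⟩, fun ⟨hs, ht⟩ g v ↦ ?_⟩
  -- `g` acts as a word `w`; then `w⁻¹ g` acts trivially on `M`, hence on `V`
  have key : ∀ w : Q, (∀ u : V, f (w • u) = w • f u) → (∀ m : M, g • m = w • m) → f (g • v) = g • f v := by
    intro w hw hgw
    have htriv : ∀ m : M, (w⁻¹ * g) • m = m := fun m ↦ by rw [mul_smul, hgw, inv_smul_smul]
    have e : g • v = w • ((w⁻¹ * g) • v) := by rw [← mul_smul, mul_inv_cancel_left]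
    rw [e, hVN _ htriv, hw, ← hgw]
  have hσσ : ∀ u : V, f ((σ * σ) • u) = (σ * σ) • f u := fun u ↦ by rw [mul_smul, hs, hs, mul_smul]
  rcases smul_cases_S3 h4 h2 hσ hm₀ hτ0 hτ g with e | e | e | e | e | e
  · exact key 1 (fun u ↦ by rw [one_smul, one_smul]) (fun m ↦ by rw [one_smul]; exact e m)
  · exact key σ hs e
  · exact key (σ * σ) hσσ e
  · exact key τ ht e
  · exact key (τ * σ) (fun u ↦ by rw [mul_smul, ht, hs, mul_smul]) e
  · exact key (τ * σ * σ) (fun u ↦ by rw [mul_smul, mul_smul, ht, hs, hs, mul_smul, mul_smul]) e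

end Relations

/-! ## §2 Averaging over `τ`: `#Hom_σ ≤ #Hom_{σ,τ}²` and `#Hom_{σ,τ} ≤ #Hom_σ` -/

section Averaging

variable (h4 : Nat.card M = 4) (h2 : ∀ m : M, m + m = 0) {σ τ : Q} {m₀ : M}
  (hσ : ∀ m : M, σ • m = m → m = 0) (hm₀ : m₀ ≠ 0) (hτ0 : τ • m₀ = m₀) (hτ : ¬ ∀ m : M, τ • m = m)
  (hVN : ∀ g : Q, (∀ m : M, g • m = m) → ∀ v : V, g • v = v)
include h4 h2 hσ hm₀ hτ0 hτ hVN

/-- **`#Hom_σ(V, M) ≤ #Hom_{σ,τ}(V, M)²`** (finite `V`): the averaging operator `T f = f + τ f τ` is an additive map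
from the `σ`-equivariant maps to the `σ,τ`-equivariant ones (`τσ = σ²τ`, `τσ² = στ`, `τ² = 1`), and its kernel
consists of `τ`-equivariant maps (`-1 = 1` on `M`); so `#Hom_σ = #im T · #ker T ≤ #Hom_{σ,τ}²`.
[cite: SerreGaloisCohomology1997, I §5.1] -/
theorem natCard_sigmaEquivariant_le_sq [Finite V] :
    Nat.card {f : V →+ M // ∀ v : V, f (σ • v) = σ • f v} ≤
      Nat.card {f : V →+ M // (∀ v : V, f (σ • v) = σ • f v) ∧ ∀ v : V, f (τ • v) = τ • f v} ^ 2 := by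
  classical
  haveI : Finite M := Nat.finite_of_card_ne_zero (by rw [h4]; norm_num)
  haveI : Finite (V →+ M) := Finite.of_injective (fun f : V →+ M ↦ (f : V → M)) DFunLike.coe_injective
  have hττ := tau_tau h4 h2 hσ hm₀ hτ0 hτ
  have hτσσ := tau_sigma_sigma h4 h2 hσ hm₀ hτ0 hτ
  have hττV := tau_tau_V h4 h2 hσ hm₀ hτ0 hτ hVN
  have hτσV := tau_sigma_V h4 h2 hσ hm₀ hτ0 hτ hVN
  -- the two subgroups of `V →+ M`
  let Lσ : AddSubgroup (V →+ M) :=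
    { carrier := {f | ∀ v : V, f (σ • v) = σ • f v}
      zero_mem' := fun v ↦ by rw [AddMonoidHom.zero_apply, AddMonoidHom.zero_apply, smul_zero]
      add_mem' := fun {f g} hf hg v ↦ by rw [AddMonoidHom.add_apply, AddMonoidHom.add_apply, hf, hg, smul_add]
      neg_mem' := fun {f} hf v ↦ by rw [AddMonoidHom.neg_apply, AddMonoidHom.neg_apply, hf, smul_neg] }
  let Lστ : AddSubgroup (V →+ M) :=
    { carrier := {f | (∀ v : V, f (σ • v) = σ • f v) ∧ ∀ v : V, f (τ • v) = τ • f v}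
      zero_mem' := ⟨fun v ↦ by rw [AddMonoidHom.zero_apply, AddMonoidHom.zero_apply, smul_zero],
        fun v ↦ by rw [AddMonoidHom.zero_apply, AddMonoidHom.zero_apply, smul_zero]⟩
      add_mem' := fun {f g} hf hg ↦ ⟨fun v ↦ by
          rw [AddMonoidHom.add_apply, AddMonoidHom.add_apply, hf.1, hg.1, smul_add],
        fun v ↦ by rw [AddMonoidHom.add_apply, AddMonoidHom.add_apply, hf.2, hg.2, smul_add]⟩
      neg_mem' := fun {f} hf ↦ ⟨fun v ↦ by rw [AddMonoidHom.neg_apply, AddMonoidHom.neg_apply, hf.1, smul_neg],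
        fun v ↦ by rw [AddMonoidHom.neg_apply, AddMonoidHom.neg_apply, hf.2, smul_neg]⟩ }
  have hLσ : ∀ f : V →+ M, f ∈ Lσ ↔ ∀ v : V, f (σ • v) = σ • f v := fun _ ↦ Iff.rfl
  have hLστ : ∀ f : V →+ M, f ∈ Lστ ↔ (∀ v : V, f (σ • v) = σ • f v) ∧ ∀ v : V, f (τ • v) = τ • f v :=
    fun _ ↦ Iff.rfl
  -- the conjugate `τ f τ` and the averaging operator `T`
  let c : (V →+ M) →+ (V →+ M) :=
    { toFun := fun f ↦ (DistribSMul.toAddMonoidHom M τ).comp (f.comp (DistribSMul.toAddMonoidHom V τ))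
      map_zero' := by ext v; simp
      map_add' := fun f g ↦ by ext v; simp [smul_add] }
  have hc : ∀ (f : V →+ M) (v : V), c f v = τ • f (τ • v) := fun _ _ ↦ rfl
  have hcσ : ∀ f : V →+ M, f ∈ Lσ → c f ∈ Lσ := fun f hf v ↦ by
    rw [hc, hc, hτσV, hf, hf, hτσσ]
  let T : Lσ →+ Lστ :=
    { toFun := fun f ↦ ⟨f.1 + c f.1, ⟨(hLσ _).mp (Lσ.add_mem f.2 (hcσ f.1 f.2)), fun v ↦ by
        rw [AddMonoidHom.add_apply, AddMonoidHom.add_apply, hc, hc, hττV, smul_add, hττ, add_comm]⟩⟩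
      map_zero' := Subtype.ext (by simp)
      map_add' := fun f g ↦ Subtype.ext (by
        simp only [AddSubgroup.coe_add, map_add]; abel) }
  have hT : ∀ f : Lσ, ((T f : Lστ) : V →+ M) = f.1 + c f.1 := fun _ ↦ rfl
  -- the kernel of `T` consists of `τ`-equivariant maps
  have hker : ∀ f : Lσ, f ∈ T.ker → (f.1 : V →+ M) ∈ Lστ := by
    intro f hf
    rw [AddMonoidHom.mem_ker] at hf
    have h0 : f.1 + c f.1 = 0 := by rw [← hT, hf]; rfl
    refine ⟨f.2, fun v ↦ ?_⟩
    have hv := congrArg (fun g : V →+ M ↦ g (τ • v)) h0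
    simp only [AddMonoidHom.add_apply, hc, hττV, AddMonoidHom.zero_apply] at hv
    -- `hv : f (τ v) + τ • f v = 0`
    rw [← klein_neg_eq h2 (τ • f.1 v)]
    exact eq_neg_of_add_eq_zero_left hv
  let ι : T.ker → Lστ := fun f ↦ ⟨(f.1 : Lσ).1, hker f.1 f.2⟩
  have hι : Function.Injective ι := by
    intro f g hfg
    apply Subtype.ext; apply Subtype.ext
    exact congrArg (fun x : Lστ ↦ (x : V →+ M)) hfg
  -- counting
  have e1 : Nat.card Lσ = Nat.card (Lσ ⧸ T.ker) * Nat.card T.ker :=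
    AddSubgroup.card_eq_card_quotient_mul_card_addSubgroup T.ker
  have e2 : Nat.card (Lσ ⧸ T.ker) = Nat.card T.range :=
    Nat.card_congr (QuotientAddGroup.quotientKerEquivRange T).toEquiv
  have e3 : Nat.card T.range ≤ Nat.card Lστ := AddSubgroup.card_le_card_addGroup T.range
  have e4 : Nat.card T.ker ≤ Nat.card Lστ := Nat.card_le_card_of_injective ι hι
  have eσ : Nat.card {f : V →+ M // ∀ v : V, f (σ • v) = σ • f v} = Nat.card Lσ :=
    Nat.card_congr (Equiv.subtypeEquivRight fun f ↦ (hLσ f).symm)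
  have eστ : Nat.card {f : V →+ M // (∀ v : V, f (σ • v) = σ • f v) ∧ ∀ v : V, f (τ • v) = τ • f v} =
      Nat.card Lστ := Nat.card_congr (Equiv.subtypeEquivRight fun f ↦ (hLστ f).symm)
  rw [eσ, eστ, e1, e2, sq]
  exact Nat.mul_le_mul e3 e4

omit h2 hσ hm₀ hτ0 hτ hVN in
/-- `#Hom_{σ,τ}(V, M) ≤ #Hom_σ(V, M)` (forget `τ`). [folklore] -/
theorem natCard_sigmaTauEquivariant_le [Finite V] :
    Nat.card {f : V →+ M // (∀ v : V, f (σ • v) = σ • f v) ∧ ∀ v : V, f (τ • v) = τ • f v} ≤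
      Nat.card {f : V →+ M // ∀ v : V, f (σ • v) = σ • f v} := by
  haveI : Finite M := Nat.finite_of_card_ne_zero (by rw [h4]; norm_num)
  haveI : Finite (V →+ M) := Finite.of_injective (fun f : V →+ M ↦ (f : V → M)) DFunLike.coe_injective
  refine Nat.card_le_card_of_injective
    (fun f : {f : V →+ M // (∀ v : V, f (σ • v) = σ • f v) ∧ ∀ v : V, f (τ • v) = τ • f v} ↦
      (⟨f.1, f.2.1⟩ : {f : V →+ M // ∀ v : V, f (σ • v) = σ • f v})) fun f g h ↦ ?_
  have h' : f.1 = g.1 := congrArg (fun x : {f : V →+ M // ∀ v : V, f (σ • v) = σ • f v} ↦ x.1) h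
  exact Subtype.ext h'

end Averaging

/-! ## §3 The counting lemma for `Q̄ = S₃`: `½ dim (1 − e₁)V ≤ dim Hom_{S₃}(V, V₄) ≤ dim (1 − e₁)V` -/

section S3

/-- **Counting lemma for `Q̄ = S₃`** (PERFECT-DESCENT.md §3 (iii), the case `G_∞ ≅ S₃`). Let `Q` act on the Klein
four-group `M` with a fixed-point-free `σ` and a non-trivial `τ` fixing `m₀ ≠ 0` (so `Q̄ = ⟨σ̄, τ̄⟩ = Aut(M) ≅ S₃`), and
on a finite additive group `V` with `v + v = 0` on which the kernel of the action on `M` acts trivially. Then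
`#((1 − e₁)V) ≤ #Hom_Q(V, M)²` and `#Hom_Q(V, M) ≤ #((1 − e₁)V)`, where `(1 − e₁)V = {w | w + σ w + σ² w = 0}`:
`½ · dim_{𝔽₂}(1 − e₁)V ≤ dim_{𝔽₂} Hom_{S₃}(V, V₄) ≤ dim_{𝔽₂}(1 − e₁)V` (`natCard_equivariant_eq_of_no_transposition`
is the `C₃`-case `dim = dim`). In particular `Hom_{S₃}(V, V₄)` is trivial iff `e₁ = 1` on `V`, and along a tower of
finite `V` it stays bounded iff `(1 − e₁)V` does. [cite: SerreGaloisCohomology1997, I §5.1] -/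
theorem natCard_equivariant_S3_bounds [Finite V] (h4 : Nat.card M = 4) (h2 : ∀ m : M, m + m = 0) {σ τ : Q}
    {m₀ : M} (hσ : ∀ m : M, σ • m = m → m = 0) (hm₀ : m₀ ≠ 0) (hτ0 : τ • m₀ = m₀) (hτ : ¬ ∀ m : M, τ • m = m)
    (hVN : ∀ g : Q, (∀ m : M, g • m = m) → ∀ v : V, g • v = v) (hV2 : ∀ v : V, v + v = 0) :
    Nat.card {w : V // w + σ • w + σ • (σ • w) = 0} ≤
        Nat.card {f : V →+ M // ∀ (g : Q) (v : V), f (g • v) = g • f v} ^ 2 ∧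
      Nat.card {f : V →+ M // ∀ (g : Q) (v : V), f (g • v) = g • f v} ≤
        Nat.card {w : V // w + σ • w + σ • (σ • w) = 0} := by
  have e : Nat.card {f : V →+ M // ∀ (g : Q) (v : V), f (g • v) = g • f v} =
      Nat.card {f : V →+ M // (∀ v : V, f (σ • v) = σ • f v) ∧ ∀ v : V, f (τ • v) = τ • f v} :=
    Nat.card_congr (Equiv.subtypeEquivRight fun f ↦ equivariant_iff_sigma_tau h4 h2 hσ hm₀ hτ0 hτ hVN f)
  rw [e, ← natCard_sigmaEquivariant_eq h4 h2 hσ hVN hV2]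
  exact ⟨natCard_sigmaEquivariant_le_sq h4 h2 hσ hm₀ hτ0 hτ hVN, natCard_sigmaTauEquivariant_le h4⟩

end S3

end Summit.BirchSwinnertonDyer.BirchSwinnertonDyer.Theorems.AlignedTransportAtTwoFineRoad.PerfectDescent
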